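import Summits.ABC.IUTFork.Cor312LicenceContentCriterion
import Summits.ABC.IUTFork.Cor312ThetaSlotLocalGeContentHull
import HarnessLib

/-!
# [IUTchIII] Cor. 3.12, Step (xi-f) IN READING (P): the q-region inside the SLOT hull of a PRESENTED packet — decided, for ANY typed
# setting, by the content of the LAST-slot box alone and the OUTER RADII of the unit-log lattices (generic criterion, slot twin)

PROOF-ONLY file (D-0012; no definitions, no `Prop` facts, no instances) of the abc-iut cell (branch C certificate seat abc-iut-C-cert-2 gen 4;
row «P:M-SLOT-LICENCE-EXACT», part 1 of 2). The reading-(P) twin of abc-iut-w5-d166's GENERIC licence criterion `Cor312LicenceContentCriterion`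
(p466106, `qRegion_subset_thetaHull_iff_of_content`: the q-region inside the hull of the union of ALL possible images), for abc-iut-C-cert-2's
(Ind1)-FREE slot hull `Cor312.Setting.thetaSlotHull` (`Cor312SlotHull.lean`, p458847: the hull of the (Ind2)-translates of the (Ind3)-region ONLY)
— i.e. for the S-side clause `SlotLicence` of the γ / joint certificates of branch C (K line p458998 / p462946 / p464071 / p464272; M line p469493 /
p469550 / p469640). TAKES NO SIDE on [IUTchIII] Cor. 3.12 (kurims manuscript p. 173–174; Step (xi-f) p. 184) or on the reading (U)/(P).

For a setting `P` whose hull frame at `(j, v_ℚ)` is the pulled-back real frame of a `p`-adic presentation `Pr` (`hframe`) and whose q-region there is the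
pulled-back polydisc of a centre `c_q` (`hq`):
* §1 `norm_centre_le_of_qRegion_subset_thetaSlotHull` (NECESSITY) — if the union of the SLOT images lies summand-wise in `p^{m(v⃗)}·log_p(R_{v⃗}^×)`
  (`hsub`; for the slot images this follows from the (Ind3)-region alone, abc-iut-s2-p7 `sUnion_thetaSlotImages_subset_preimage_pi_zpow_smul_logPacket`,
  NO capsule symmetry), then `qRegion ⊆ thetaSlotHull` forces `‖c_{q,(v⃗,J)}‖ ≤ ‖p^{m(v⃗)}‖·∏_a ‖cout(v⃗_a)‖` for any norm-dominating family `cout`;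
* §1 `qRegion_subset_thetaSlotHull_of_norm_centre_le` (SUFFICIENCY) — if every summand carries IN THE (Ind3)-REGION a vector of content EXACTLY `p^{m(v⃗)}`
  (`hwit`), every factorwise family of shell-preserving automorphisms is realised by an (Ind2)-FAMILY (`hism`, abc-iut-s2-p7
  `exists_ind2Family_comparison_eq_congr` from FULLNESS of Ism), and `‖c_{q,(v⃗,J)}‖ ≤ ‖p^{m(v⃗)}‖·∏_a ‖cout(v⃗_a)‖` with `cout(v) ∈ log_p(𝒪_v^×)`,
  then `qRegion ⊆ thetaSlotHull` (a hull-set containing the slot images contains summand-wise the `ℤ_p`-span of the factorwise orbit of the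
  exact-content vector, i.e. `p^{m(v⃗)}·log_p(R_{v⃗}^×)` — abc-iut-s2-p9's mechanism in abc-iut-s2-p7's slot form, Literature
  `smul_logPacket_subset_closure_factorwiseOrbit`);
* §1 **`qRegion_subset_thetaSlotHull_iff_of_content`** — THE GENERIC SLOT CRITERION;
* §2 `Cor312.Setting.slotLicence_iff` — `SlotLicence P ↔ ∀ i v_ℚ, qRegion (i+1) v_ℚ ⊆ thetaSlotHull (i+1) v_ℚ` (`Iff.rfl`, for rewriting).

Part 2 (`Cor312SlotLicenceExactContentM`) instantiates this at abc-iut-s2-p8's M-level sharp setting, where Ism is FULL (abc-iut-s2-p9) and the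
region is the product of the last-slot boxes, so that `m(v⃗)` = the exact content of the LAST-slot box `ι_j(t_{Θ,j,v̲_j})·(R_I)^∼` ALONE (vs the
(Ind1)-slot UNION over all `a` on the (U) line). [cite: Mochizuki2012, IUTchIII Cor. 3.12 p. 173–174, Step (x) p. 181, Step (xi-f) p. 184; Thm. 3.11 (i)
(Ind2) p. 154; Rmk. 3.9.5 (i)(ii) p. 127; IUTchIV Prop. 1.2 (i) p. 10, Prop. 1.4 (i) p. 13] [cite: DupuyHilado2025, §3.9, §4.9, §4.11–4.12]
[cite: WeilBNT1967, Ch. II §2, Th. 1–2] [claim: Mochizuki2012, status: disputed] for every IUT sentence quoted. HONEST SCOPE: `SlotLicence` is a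
STRONGER-THAN-PRINT set-level reading of Step (xi-f) (print: hull of the union of ALL possible images, p. 184 l. 26–29); OUR sharp containers, OUR
typed (Ind2)/(Ind3); nothing here bears on the printed GLOBAL inequality or on the NUMBER-level Corollary; typed ≠ proved (these: proved);
instantiated ≠ endorsed; refuted/inhabited-as-typed ≠ in print.
-/

noncomputable section

open Set Function NumberField IsDedekindDomain
open scoped Pointwise

namespace Summit.ABC.IUTFork.Cor312Vol

open Thm311 Cor312 Literature.IUT.LogThetaLattice Literature.IUT.LogVolume

/-! ## §1. Generic: the q-region inside the SLOT hull of a presented packet, by the last-slot content and the outer radii -/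

section Setting

open PadicPresentation

variable {T : ThetaIndex} {S : Situation T} {P : Cor312.Setting S} {vQ : T.VQ} {p : ℕ} [hp : Fact p.Prime]
  (Pr : PadicPresentation S.L vQ p)

/-- **Necessity (slot form).** Let the hull frame of `P` at `(j, v_ℚ)` be the pulled-back real frame of `Pr` (`hframe`) and the q-region there the
pulled-back polydisc `λ_q·𝒪_L` of a centre `c_q` (`hq`). If the union of the SLOT images of the Θ-pilot lies summand-wise in `p^{m(v⃗)}·log_p(R_{v⃗}^×)`
(`hsub`), then `qRegion ⊆ thetaSlotHull` forces, at every summand `v⃗` and field factor `J`, `‖c_{q,(v⃗,J)}‖ ≤ ‖p^{m(v⃗)}‖·∏_a ‖cout(v⃗_a)‖` for any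
family `cout` dominating the `log_p(𝒪^×)` in norm: the pulled-back polydisc of exactly these radii is a hull-set containing every slot image, hence
the slot hull, hence the q-centre. Twin of abc-iut-w5-d166's `norm_centre_le_of_qRegion_subset_thetaHull`.
[cite: Mochizuki2012, IUTchIII Rmk. 3.9.5 (i)(ii) p. 127; IUTchIV Prop. 1.2 (i) p. 10] [cite: DupuyHilado2025, §4.12] -/
theorem norm_centre_le_of_qRegion_subset_thetaSlotHull (j : T.Label) [Fintype (Pr.factorIdx j)]
    (hframe : P.frame j vQ = HullFrame.ofComparison (Pr.factorField j) (fun x => Pr.factorMap j x))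
    (cq : ∀ s : Pr.factorIdx j, Pr.factorField j s)
    (hq : P.qRegion j vQ = (fun x => Pr.factorMap j x) ⁻¹' hullSet (Pr.factorField j) cq)
    (m : (T.Caps j → T.Fibre vQ) → ℤ)
    (hsub : ⋃₀ P.thetaSlotImages j vQ ⊆ Pr.comparison j ⁻¹' Set.pi univ
      fun e => ((p : ℚ_[p]) ^ m e) • (logPacket p (Pr.kk e) : Set (Pr.X e)))
    (cout : ∀ v : T.Fibre vQ, Pr.k v) (hdom : ∀ v, ∀ z ∈ logUnits (Pr.k v), ‖z‖ ≤ ‖cout v‖)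
    (h : P.qRegion j vQ ⊆ P.thetaSlotHull j vQ) (e : T.Caps j → T.Fibre vQ) (J : DIdx p (Pr.kk e)) :
    ‖cq ⟨e, J⟩‖ ≤ ‖((p : ℚ_[p]) ^ m e)‖ * ∏ a, ‖cout (e a)‖ := by
  classical
  haveI : Nonempty (T.Caps j) := ⟨0⟩
  -- the hull-set of radii `‖p^{m(v⃗)}‖·∏ρ_out`: centre `ψ_{v⃗}(p^{m(v⃗)}·⊗ cout(v⃗_a))`
  have hz0 : ∀ (e' : T.Caps j → T.Fibre vQ) (a : T.Caps j), cout (e' a) ≠ 0 :=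
    fun e' a => ne_zero_of_isMaxOn_logUnits p (Pr.kk e' a) (hdom (e' a))
  let c₀ : ∀ s : Pr.factorIdx j, Pr.factorField j s := fun s =>
    dEquiv p (Pr.kk s.1) (((p : ℚ_[p]) ^ m s.1) • purePacket p (Pr.kk s.1) fun a => cout (s.1 a)) s.2
  have hc₀norm : ∀ (e' : T.Caps j → T.Fibre vQ) (J' : DIdx p (Pr.kk e')),
      ‖c₀ ⟨e', J'⟩‖ = ‖((p : ℚ_[p]) ^ m e')‖ * ∏ a, ‖cout (e' a)‖ := fun e' J' => by
    show ‖dEquiv p (Pr.kk e') (((p : ℚ_[p]) ^ m e') • purePacket p (Pr.kk e') fun a => cout (e' a)) J'‖ = _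
    rw [map_smul, Pi.smul_apply, norm_smul, psi_purePacket_apply, norm_prod]
    exact congrArg _ (Finset.prod_congr rfl fun a _ => norm_factorEmb p (Pr.kk e') (DFac p (Pr.kk e')) _ a J' _)
  have hc₀ : ∀ s, c₀ s ≠ 0 := by
    rintro ⟨e', J'⟩
    rw [← norm_pos_iff, hc₀norm]
    refine mul_pos (norm_pos_iff.mpr (zpow_ne_zero _ (Nat.cast_ne_zero.mpr hp.out.ne_zero))) ?_
    exact Finset.prod_pos fun a _ => norm_pos_iff.mpr (hz0 e' a)
  -- it is a hull-set of the frame …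
  have hH₀ : (fun x => Pr.factorMap j x) ⁻¹' hullSet (Pr.factorField j) c₀ ∈ (P.frame j vQ).Hul := by
    rw [hframe]
    exact ⟨hullSet (Pr.factorField j) c₀, ⟨c₀, hc₀, rfl⟩, rfl⟩
  -- … containing every slot image
  have hUH₀ : ⋃₀ P.thetaSlotImages j vQ ⊆ (fun x => Pr.factorMap j x) ⁻¹' hullSet (Pr.factorField j) c₀ := by
    intro x hx
    have hx' := hsub hx
    rw [Set.mem_preimage, Set.mem_univ_pi] at hx'
    rw [Set.mem_preimage, hullSet, mem_polydisc]
    rintro ⟨e', J'⟩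
    rw [hc₀norm]
    exact norm_dEquiv_le_of_mem_zpow_smul_logPacket_of_isMaxOn p (Pr.kk e') (m e') (fun a => hdom (e' a)) (hx' e') J'
  -- hence the slot hull, hence the q-region, hence the q-centre
  have hqH₀ : P.qRegion j vQ ⊆ (fun x => Pr.factorMap j x) ⁻¹' hullSet (Pr.factorField j) c₀ :=
    h.trans ((P.frame j vQ).hull_subset_of_mem hH₀ hUH₀)
  obtain ⟨xq, hxq⟩ := Pr.factorMap_surjective j cq
  have hxq' : ∀ s, Pr.factorMap j xq s = cq s := fun s => congrFun hxq s
  have hmem : xq ∈ P.qRegion j vQ := by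
    rw [hq, Set.mem_preimage, hullSet, mem_polydisc]
    intro s
    rw [hxq' s]
  have hle := hqH₀ hmem
  rw [Set.mem_preimage, hullSet, mem_polydisc] at hle
  have := hle ⟨e, J⟩
  rw [hxq' ⟨e, J⟩, hc₀norm] at this
  exact this

/-- **Sufficiency (slot form).** With `hframe`, `hq` as above: if every summand `v⃗` carries IN THE (Ind3)-REGION a vector of content EXACTLY
`p^{m(v⃗)}` (`hwit`), every factorwise family of shell-preserving `ℚ_p`-linear automorphisms is realised on `v⃗` by an (Ind2)-FAMILY (`hism`), and
`‖c_{q,(v⃗,J)}‖ ≤ ‖p^{m(v⃗)}‖·∏_a ‖cout(v⃗_a)‖` for elements `cout(v) ∈ log_p(𝒪^×_{K_v})`, then `qRegion ⊆ thetaSlotHull`: a hull-set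
`e⁻¹(Π_{v⃗} ψ_{v⃗}⁻¹(λ_{v⃗}·𝒪))` containing the slot images contains summand-wise the `ℤ_p`-span of the factorwise (Ind2)-orbit of the exact-content
vector of the region (translates of the region by (Ind2)-families ARE slot images), i.e. `p^{m(v⃗)}·log_p(R_{v⃗}^×)` (abc-iut-s2-p9's mechanism in
abc-iut-s2-p7's slot form, Literature `smul_logPacket_subset_closure_factorwiseOrbit`), in particular `p^{m(v⃗)}·⊗cout(v⃗_a)`, so its radii dominate the
q-radii. Twin of abc-iut-w5-d166's `qRegion_subset_thetaHull_of_norm_centre_le`. [cite: Mochizuki2012, IUTchIII Thm. 3.11 (i) (Ind2) p. 154;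
Rmk. 3.9.5 (ii) p. 127] [cite: DupuyHilado2025, §4.9, §4.11–4.12] [cite: WeilBNT1967, Ch. II §2, Th. 1] -/
theorem qRegion_subset_thetaSlotHull_of_norm_centre_le (j : T.Label) [Fintype (Pr.factorIdx j)]
    (hframe : P.frame j vQ = HullFrame.ofComparison (Pr.factorField j) (fun x => Pr.factorMap j x))
    (cq : ∀ s : Pr.factorIdx j, Pr.factorField j s)
    (hq : P.qRegion j vQ = (fun x => Pr.factorMap j x) ⁻¹' hullSet (Pr.factorField j) cq)
    (m : (T.Caps j → T.Fibre vQ) → ℤ)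
    (hwit : ∀ e : T.Caps j → T.Fibre vQ, ∃ x ∈ P.thetaRegion3 j vQ,
      Pr.comparison j x e ∈ ((p : ℚ_[p]) ^ m e) • (logPacket p (Pr.kk e) : Set (Pr.X e)) ∧
      Pr.comparison j x e ∉ ((p : ℚ_[p]) ^ (m e + 1)) • (logPacket p (Pr.kk e) : Set (Pr.X e)))
    (hism : ∀ (e : T.Caps j → T.Fibre vQ) (g' : ∀ a, Pr.kk e a ≃ₗ[ℚ_[p]] Pr.kk e a),
      (∀ a, g' a '' logUnits (Pr.kk e a) = logUnits (Pr.kk e a)) →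
      ∃ Φ ∈ S.L.Ind2Family, ∀ x, Pr.comparison j (Φ j vQ x) e =
        (PiTensorProduct.congr g' : Pr.X e ≃ₗ[ℚ_[p]] Pr.X e) (Pr.comparison j x e))
    (cout : ∀ v : T.Fibre vQ, Pr.k v) (houtΛ : ∀ v, cout v ∈ logUnits (Pr.k v))
    (hle : ∀ (e : T.Caps j → T.Fibre vQ) (J : DIdx p (Pr.kk e)), ‖cq ⟨e, J⟩‖ ≤ ‖((p : ℚ_[p]) ^ m e)‖ * ∏ a, ‖cout (e a)‖) :
    P.qRegion j vQ ⊆ P.thetaSlotHull j vQ := by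
  classical
  haveI : Nonempty (T.Caps j) := ⟨0⟩
  intro y hy
  show y ∈ (P.frame j vQ).hull (⋃₀ P.thetaSlotImages j vQ)
  by_cases hb : (P.frame j vQ).IsBounded (⋃₀ P.thetaSlotImages j vQ)
  swap
  · rw [HullFrame.hull, if_neg hb]; exact Set.mem_univ _
  rw [HullFrame.hull, if_pos hb]
  refine Set.mem_sInter.mpr ?_
  rintro H ⟨hH, hUH⟩
  rw [hframe] at hH
  obtain ⟨H', hH', rfl⟩ := hH
  obtain ⟨c, hc, rfl⟩ := (HullFrame.mem_ofLocalFields_hul _).mp hH'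
  -- `y ∈ λ_q·𝒪_L`; it suffices that the radii of `H` dominate the q-radii
  rw [hq, Set.mem_preimage, hullSet, mem_polydisc] at hy
  rw [Set.mem_preimage, hullSet, mem_polydisc]
  rintro ⟨e, J⟩
  refine (hy ⟨e, J⟩).trans ((hle e J).trans ?_)
  -- the summand component `W_{v⃗}` of `H` contains the projection of the union of the slot images …
  rw [Pr.factorMap_preimage_hullSet] at hUH
  have hUW : ∀ x ∈ ⋃₀ P.thetaSlotImages j vQ,
      Pr.comparison j x e ∈ dEquiv p (Pr.kk e) ⁻¹' hullSet (DFac p (Pr.kk e)) fun i' => c ⟨e, i'⟩ := by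
    intro x hx
    have hx' := hUH hx
    rw [Set.mem_preimage, Set.mem_univ_pi] at hx'
    exact hx' e
  -- … which contains the factorwise orbit of the projection of the (Ind3)-region (translates by (Ind2)-families are slot images) …
  have hstab : ∀ g' : ∀ a, Pr.kk e a ≃ₗ[ℚ_[p]] Pr.kk e a, (∀ a, g' a '' logUnits (Pr.kk e a) = logUnits (Pr.kk e a)) →
      (PiTensorProduct.congr g' : Pr.X e ≃ₗ[ℚ_[p]] Pr.X e) '' ((fun x => Pr.comparison j x e) '' P.thetaRegion3 j vQ) ⊆
        (fun x => Pr.comparison j x e) '' ⋃₀ P.thetaSlotImages j vQ := by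
    intro g' hg'
    obtain ⟨Φ, hΦ, hΦe⟩ := hism e g' hg'
    rintro _ ⟨_, ⟨y', hy', rfl⟩, rfl⟩
    exact ⟨Φ j vQ y', Set.mem_sUnion.mpr ⟨Φ j vQ '' P.thetaRegion3 j vQ, ⟨Φ, hΦ, rfl⟩, Set.mem_image_of_mem _ hy'⟩, hΦe y'⟩
  -- … and the region's projection contains a vector of content exactly `p^{m(v⃗)}`: so `W_{v⃗} ⊇ p^{m(v⃗)}·log_p(R_{v⃗}^×)`
  obtain ⟨x, hxR, hxm, hxm1⟩ := hwit e
  have hA := smul_logPacket_subset_closure_factorwiseOrbit p (Pr.kk e)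
    (M := (fun x => Pr.comparison j x e) '' P.thetaRegion3 j vQ)
    (Set.mem_image_of_mem _ hxR) hxm (zpow_content p (Pr.kk e) hxm hxm1).2
  have hMW : packetHull p (Pr.kk e) ((fun x => Pr.comparison j x e) '' ⋃₀ P.thetaSlotImages j vQ) ⊆
      dEquiv p (Pr.kk e) ⁻¹' hullSet (DFac p (Pr.kk e)) fun i' => c ⟨e, i'⟩ :=
    Pr.packetHull_subset_preimage_hullSet e _ (by rintro _ ⟨x', hx', rfl⟩; exact hUW x' hx')
  have hΛW : ((p : ℚ_[p]) ^ m e) • (logPacket p (Pr.kk e) : Set (Pr.X e)) ⊆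
      dEquiv p (Pr.kk e) ⁻¹' hullSet (DFac p (Pr.kk e)) fun i' => c ⟨e, i'⟩ := by
    refine hA.trans fun w hw => hMW ?_
    have hle' : AddSubgroup.closure (⋃ g' ∈ {g' : ∀ a, Pr.kk e a ≃ₗ[ℚ_[p]] Pr.kk e a |
          ∀ a, g' a '' logUnits (Pr.kk e a) = logUnits (Pr.kk e a)},
        (PiTensorProduct.congr g' : Pr.X e ≃ₗ[ℚ_[p]] Pr.X e) ''
          ((fun x => Pr.comparison j x e) '' P.thetaRegion3 j vQ)) ≤
        (packetSpan p (Pr.kk e) ((fun x => Pr.comparison j x e) '' ⋃₀ P.thetaSlotImages j vQ)).toAddSubgroup := by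
      rw [AddSubgroup.closure_le]
      exact (Set.iUnion₂_subset fun g' hg' => hstab g' hg').trans (subset_packetHull p (Pr.kk e) _)
    exact hle' hw
  -- the outer radius is attained at `p^{m(v⃗)}·⊗cout(v⃗_a) ∈ p^{m(v⃗)}·log_p(R_{v⃗}^×) ⊆ W_{v⃗}`
  obtain ⟨hwmem, hwnorm⟩ := zpow_smul_purePacket_mem_and_norm p (Pr.kk e) (m e) (z := fun a => cout (e a))
    (fun a => houtΛ (e a))
  have hwW := hΛW hwmem
  rw [Set.mem_preimage, hullSet, mem_polydisc] at hwW
  have := hwW J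
  rw [hwnorm J] at this
  exact this

/-- **THE GENERIC SLOT CRITERION** (necessity + sufficiency): under `hframe`, `hq`, with `m` the summand-wise EXACT content of the (Ind3)-region's
projection — equivalently of the LAST-slot box — (`hsub` for the slot images + `hwit` in the region) and Ism full on the summands, landing in the
(Ind2)-families (`hism`), for any family `cout` of elements of LARGEST norm in the `log_p(𝒪^×_{K_v})`:
`qRegion (j,v_ℚ) ⊆ thetaSlotHull (j,v_ℚ)` ⟺ `∀ v⃗ J, ‖c_{q,(v⃗,J)}‖ ≤ ‖p^{m(v⃗)}‖·∏_a ‖cout(v⃗_a)‖`. Twin of abc-iut-w5-d166's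
`qRegion_subset_thetaHull_iff_of_content` with the (Ind1)-FREE slot hull. [cite: Mochizuki2012, IUTchIII Cor. 3.12 Step (x) p. 181, Step (xi-f) p. 184;
Thm. 3.11 (i) (Ind2) p. 154] [cite: DupuyHilado2025, §4.9, §4.11–4.12] -/
theorem qRegion_subset_thetaSlotHull_iff_of_content (j : T.Label) [Fintype (Pr.factorIdx j)]
    (hframe : P.frame j vQ = HullFrame.ofComparison (Pr.factorField j) (fun x => Pr.factorMap j x))
    (cq : ∀ s : Pr.factorIdx j, Pr.factorField j s)
    (hq : P.qRegion j vQ = (fun x => Pr.factorMap j x) ⁻¹' hullSet (Pr.factorField j) cq)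
    (m : (T.Caps j → T.Fibre vQ) → ℤ)
    (hsub : ⋃₀ P.thetaSlotImages j vQ ⊆ Pr.comparison j ⁻¹' Set.pi univ
      fun e => ((p : ℚ_[p]) ^ m e) • (logPacket p (Pr.kk e) : Set (Pr.X e)))
    (hwit : ∀ e : T.Caps j → T.Fibre vQ, ∃ x ∈ P.thetaRegion3 j vQ,
      Pr.comparison j x e ∈ ((p : ℚ_[p]) ^ m e) • (logPacket p (Pr.kk e) : Set (Pr.X e)) ∧
      Pr.comparison j x e ∉ ((p : ℚ_[p]) ^ (m e + 1)) • (logPacket p (Pr.kk e) : Set (Pr.X e)))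
    (hism : ∀ (e : T.Caps j → T.Fibre vQ) (g' : ∀ a, Pr.kk e a ≃ₗ[ℚ_[p]] Pr.kk e a),
      (∀ a, g' a '' logUnits (Pr.kk e a) = logUnits (Pr.kk e a)) →
      ∃ Φ ∈ S.L.Ind2Family, ∀ x, Pr.comparison j (Φ j vQ x) e =
        (PiTensorProduct.congr g' : Pr.X e ≃ₗ[ℚ_[p]] Pr.X e) (Pr.comparison j x e))
    (cout : ∀ v : T.Fibre vQ, Pr.k v) (houtΛ : ∀ v, cout v ∈ logUnits (Pr.k v))
    (hdom : ∀ v, ∀ z ∈ logUnits (Pr.k v), ‖z‖ ≤ ‖cout v‖) :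
    P.qRegion j vQ ⊆ P.thetaSlotHull j vQ ↔
      ∀ (e : T.Caps j → T.Fibre vQ) (J : DIdx p (Pr.kk e)), ‖cq ⟨e, J⟩‖ ≤ ‖((p : ℚ_[p]) ^ m e)‖ * ∏ a, ‖cout (e a)‖ :=
  ⟨fun h e J => norm_centre_le_of_qRegion_subset_thetaSlotHull Pr j hframe cq hq m hsub cout hdom h e J,
    fun h => qRegion_subset_thetaSlotHull_of_norm_centre_le Pr j hframe cq hq m hwit hism cout houtΛ h⟩

end Setting

end Summit.ABC.IUTFork.Cor312Vol

/-! ## §2. `SlotLicence` unfolded, for rewriting -/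

/-- abc-iut-C-cert-2's `SlotLicence P` IS «`qRegion (i+1) v_ℚ ⊆ thetaSlotHull (i+1) v_ℚ` at every label `i+1 ∈ 𝔽_l^⋇` and every `v_ℚ`» — so the
criterion above decides the S-side clause of the γ / joint certificates packet by packet. [claim: Mochizuki2012, status: disputed] -/
theorem Summit.ABC.IUTFork.Cor312.Setting.slotLicence_iff {T : Summit.ABC.IUTFork.Thm311.ThetaIndex}
    {S : Summit.ABC.IUTFork.Thm311.Situation T} (P : Summit.ABC.IUTFork.Cor312.Setting S) :
    P.SlotLicence ↔ ∀ (i : Fin T.lstar) (vQ : T.VQ),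
      P.qRegion (Summit.ABC.IUTFork.Cor312.Setting.labelSucc i) vQ ⊆ P.thetaSlotHull (Summit.ABC.IUTFork.Cor312.Setting.labelSucc i) vQ :=
  Iff.rfl

end
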